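import Summits.ValiantsHypothesis.ValiantsHypothesis.Theorems.BarrierLeverDefinableEquationsHighestWeightVectorDominance
import Summits.ValiantsHypothesis.ValiantsHypothesis.Theorems.BarrierLeverDefinableDcEquationsHighestWeightVector

/-!
# Crux `BarrierLever.DefinableDcEquations` (stmt-ValiantsHypothesis-8746) — NORMAL FORM: highest
# weight vectors with DOMINANT weight

Corollary of `…DefinableDcEquationsHighestWeightVector.lean` (the HWV normal form of crux 8746) and
`…DefinableEquationsHighestWeightVectorDominance.lean` (`weight_monotone_of_unipInvariant`: a
`U`-invariant torus weight vector has monotone weight): crux 8746 holds iff it holds with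
witnesses that are torus weight vectors of MONOTONE weight `w_0 ≤ ⋯ ≤ w_{n-1}` invariant under the
unipotent radical (same threshold function `m`, level `a ↦ a + 7`).

HONEST FRAMING.  A normal form; nothing here bears on the open content of 8746 (dc-axis wall
`n + Θ(c n / log n)`), 8745/8749 (Chatterjee–Tengse 2023 §1.3 dir. 2), 14610 or VP vs VNP.  No
definitions, no named facts.  References: [LandsbergGCT2017] §8; [MignonRessayre2004] §1.
-/

-- layout Summits/ValiantsHypothesis/ValiantsHypothesis forces the duplicated namespace component
set_option linter.dupNamespace false

noncomputable section

open MvPolynomial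

namespace Summit.ValiantsHypothesis.ValiantsHypothesis.Theorems.BarrierLever.IsobaricEquations

open Literature.Computability.AlgebraicComplexity Literature.Barriers.ValiantsHypothesis

/-- **`DefinableDcEquations` as highest weight vectors with dominant weight** (crux
stmt-ValiantsHypothesis-8746). [cite: LandsbergGCT2017, §8] -/
theorem definableDcEquations_iff_highestWeightVectorDominant :
    Summit.ValiantsHypothesis.ValiantsHypothesis.Theses.BarrierLever.DefinableDcEquations ↔
      ∃ m : ℕ → ℕ, (∀ C : ℕ, ∃ n₀ : ℕ, ∀ n ≥ n₀, 2 ^ (C * (Nat.log 2 n + 1) ^ 2) ≤ m n) ∧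
        ∃ a n₀ : ℕ, ∀ n ≥ n₀, ∃ q : ℕ, q ≤ (Nat.choose (2 * n) n) ^ a ∧
          ∃ H : MvPolynomial (↥(degLEMonomials n) ⊕ Fin q) ℂ,
            complexity H ≤ (Nat.choose (2 * n) n) ^ a ∧ H.totalDegree ≤ (Nat.choose (2 * n) n) ^ a ∧
            boolSum H ≠ 0 ∧
            (∀ f : MvPolynomial (Fin n) ℂ, f.totalDegree ≤ n → determinantalComplexity f ≤ m n →
              eval (coeffVector (degLEMonomials n) f) (boolSum H) = 0) ∧
            (∃ (d : ℕ) (w : Fin n → ℕ), (boolSum H).IsHomogeneous d ∧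
              (∀ i : Fin n, IsWeightedHomogeneous
                (fun m : degLEMonomials n => (m : Fin n →₀ ℕ) i) (boolSum H) (w i)) ∧ Monotone w) ∧
            ∀ (t : Fin n → Fin n → ℂ) (f : MvPolynomial (Fin n) ℂ), f.totalDegree ≤ n →
              eval (coeffVector (degLEMonomials n) (aeval (unip t) f)) (boolSum H) =
                eval (coeffVector (degLEMonomials n) f) (boolSum H) := by
  rw [definableDcEquations_iff_highestWeightVector]
  constructor
  · rintro ⟨m, hgrow, a, n₀, h⟩
    refine ⟨m, hgrow, a, n₀, fun n hn => ?_⟩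
    obtain ⟨q, hq, H, hc, hd, hne, hvan, ⟨d, w, hhom, hiso⟩, hinv⟩ := h n hn
    haveI : Fintype (degLEMonomials n) := (Finsupp.finite_of_degree_le (σ := Fin n) n).fintype
    exact ⟨q, hq, H, hc, hd, hne, hvan,
      ⟨d, w, hhom, hiso, weight_monotone_of_unipInvariant hne hiso hinv⟩, hinv⟩
  · rintro ⟨m, hgrow, a, n₀, h⟩
    refine ⟨m, hgrow, a, n₀, fun n hn => ?_⟩
    obtain ⟨q, hq, H, hc, hd, hne, hvan, ⟨d, w, hhom, hiso, -⟩, hinv⟩ := h n hn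
    exact ⟨q, hq, H, hc, hd, hne, hvan, ⟨d, w, hhom, hiso⟩, hinv⟩

end Summit.ValiantsHypothesis.ValiantsHypothesis.Theorems.BarrierLever.IsobaricEquations

end
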